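import Mathlib.Algebra.Order.Round
import Summits.AnomalousDissipation.AnomalousDissipation.Theorems.SawtoothPulseCascadeK1LocalisedCascadeSymbolLattice
import Summits.AnomalousDissipation.AnomalousDissipation.Theorems.SawtoothPulseCascadeK1LocalisedCascadeSymbolProduct

/-!
# K1loc, line `Spectral` / SeqCone — helper: THE LATTICE PACKAGE OF THE TRACKED PRODUCT SYMBOLS (S-B constants, H half-slot)

Helper file of the prover lane on the crux `K1LocalisedCascade` (stmt-AnomalousDissipation-19491), route
`SawtoothPulseCascade` (glue seat k1loc-p3; Stage 1a of the concrete instantiation of ad-k1loc-p2's capstone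
`…K1Ledger.cascade_ledger_step_H`).  The tracked symbols of the H half-slot at radius `L`, envelope `(R, w) → (R′, w′)`:
  `μ̂(k) = 1 − g^S_L(k_h,k_v)·g^env_{R,w}(k_h,k_v)`,   `m̂(k) = 1 − g^M_{L₀}(k_h,k_v)·g^env_{R′,w′}(k_h,k_v)`,  `L₀ = L/(1+ε)`,
with the concrete indicators of `…SymbolLattice` and the branch shifts `b^±_n = round(±γn)`.  This file discharges the
LATTICE hypotheses of the capstone for them: `hμ1`/`hm1` (`|μ̂|, |m̂| ≤ 1`), `hone` with `R₀ = R + w` (the envelope vanishes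
beyond `R + w`), `hβp`/`hβm` with `β₀ = ½`, and the branch compatibilities `hcomp_p`/`hcomp_m` (`eq_one_of_ne_zero_H/env`,
`compat_mul`) under `a₂ ≥ a + ε_a + γ/(2L)` and `R′ ≥ (1+γ)(R+w) + ½`.  No definitions; no statement about the stub.
[cite: ElgindiLissMattingly2025, §1.2.2 (cones and cocycle)] [problem: turb]
-/

-- `Summit.<Summit>.<Problem>`: single-conjunct summit, the duplicate namespace segment is deliberate.
set_option linter.dupNamespace false

noncomputable section

namespace Summit.AnomalousDissipation.AnomalousDissipation.Theorems.SawtoothPulseCascade.K1Symbol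

open Real

/-! ## Bounds and the envelope `hone` -/

/-- `|1 − g₁g₂| ≤ 1` for `[0,1]`-valued indicators (the hypotheses `hμ1`, `hm1`). [folklore] -/
theorem abs_one_sub_prod_le_one {x₁ x₂ : ℝ} (h₁ : 0 ≤ x₁) (h₁' : x₁ ≤ 1) (h₂ : 0 ≤ x₂) (h₂' : x₂ ≤ 1) :
    |1 - x₁ * x₂| ≤ 1 :=
  abs_one_sub_le_one (mul_nonneg h₁ h₂) (mul_le_one₀ h₁' h₂ h₂')

/-- **`hμ1` for the tracked product symbol** `μ̂ = 1 − g^S·g^env`. [folklore] -/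
theorem abs_symProdS_le_one (γ ε εa a L R w : ℝ) (kh kv : ℤ) :
    |1 - smoothTransition ((|(kh : ℝ)| - L) / (ε * L)) * (1 - smoothTransition ((γ * |(kv : ℝ)| - a * |(kh : ℝ)|) / (εa * L))) *
      ((1 - smoothTransition ((|(kh : ℝ)| - R) / w)) * (1 - smoothTransition ((|(kv : ℝ)| - R) / w)))| ≤ 1 :=
  abs_one_sub_prod_le_one (symS_nonneg γ ε εa a L kh kv) (symS_le_one γ ε εa a L kh kv) (symEnv_nonneg R w kh kv)
    (symEnv_le_one R w kh kv)

/-- **`hm1` for the new product symbol** `m̂ = 1 − g^M·g^env′`. [folklore] -/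
theorem abs_symProdM_le_one (γ ε εa a₂ L₀ R w : ℝ) (kh kv : ℤ) :
    |1 - smoothTransition ((|(kh : ℝ)| - L₀) / (ε * L₀)) *
      (1 - smoothTransition ((γ * |(kv : ℝ) + γ * kh| - a₂ * |(kh : ℝ)|) / (εa * L₀)) *
        smoothTransition ((γ * |(kv : ℝ) - γ * kh| - a₂ * |(kh : ℝ)|) / (εa * L₀))) *
      ((1 - smoothTransition ((|(kh : ℝ)| - R) / w)) * (1 - smoothTransition ((|(kv : ℝ)| - R) / w)))| ≤ 1 :=
  abs_one_sub_prod_le_one (symM_nonneg γ ε εa a₂ L₀ kh kv) (symM_le_one γ ε εa a₂ L₀ kh kv) (symEnv_nonneg R w kh kv)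
    (symEnv_le_one R w kh kv)

/-- **`hone`**: beyond the envelope (`R + w ≤ |k_h|`, `w > 0`) the tracked symbol is `1` on the whole fibre `k_h = n`.
[cite: ElgindiLissMattingly2025, §1.2.2 (the cocycle A(r,s))] -/
theorem symProd_eq_one_of_le_abs {R w : ℝ} (hw : 0 < w) (gS : ℤ → ℤ → ℝ) {n : ℤ} (hn : R + w ≤ |(n : ℝ)|)
    (kh kv : ℤ) (hk : kh = n) :
    1 - gS kh kv * ((1 - smoothTransition ((|(kh : ℝ)| - R) / w)) * (1 - smoothTransition ((|(kv : ℝ)| - R) / w))) = 1 := by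
  refine one_sub_prod_eq_one_of_right_eq_zero (g₁ := gS)
    (g₂ := fun kh kv => (1 - smoothTransition ((|(kh : ℝ)| - R) / w)) * (1 - smoothTransition ((|(kv : ℝ)| - R) / w))) ?_
  by_contra h
  have h1 := (symEnv_supp hw kh kv h).1
  rw [hk] at h1
  linarith

/-! ## The branch shifts `b^±_n = round(±γn)` -/

/-- `|round(γn) − n·(γ·1)| ≤ ½` (hypothesis `hβp` with `β₀ = ½`). [folklore] -/
theorem abs_round_sub_le_pos (γ : ℝ) (n : ℤ) : |((round (γ * n) : ℤ) : ℝ) - n * (γ * 1)| ≤ 1 / 2 := by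
  rw [mul_one, abs_sub_comm, mul_comm]; exact abs_sub_round _

/-- `|round(−γn) − n·(γ·(−1))| ≤ ½` (hypothesis `hβm` with `β₀ = ½`). [folklore] -/
theorem abs_round_sub_le_neg (γ : ℝ) (n : ℤ) : |((round (-(γ * n)) : ℤ) : ℝ) - n * (γ * (-1))| ≤ 1 / 2 := by
  rw [show (n : ℝ) * (γ * (-1)) = -(γ * n) by ring, abs_sub_comm]; exact abs_sub_round _

/-- The shift in the form of the cone step: `|b − σγk_h| ≤ ½` for `b = round(σγn)`, `k_h = n`. [folklore] -/
theorem abs_round_sub_sigma_le (σ γ : ℝ) (n : ℤ) : |((round (σ * γ * n) : ℤ) : ℝ) - σ * γ * n| ≤ 1 / 2 := by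
  rw [abs_sub_comm]; exact abs_sub_round _

/-! ## Branch compatibility of the product symbols across the H half-slot -/

/-- **`hcomp` for the product symbols across the H half-slot.**  Parameters: `γ ≥ 0`, `ε, ε_a, L, w, w′ > 0`, `L₀ = L/(1+ε)`,
apertures with `a + ε_a + γ/(2L) ≤ a₂`, envelopes with `(1 + γ)(R + w) + ½ ≤ R′`.  Then on the fibre `k_h = n`, for the
shift `b = round(σγn)` of the family `σ = ±1`:
`m̂(k − b e_v)² ≤ μ̂(k)²`, `μ̂ = 1 − g^S_L·g^env_{R,w}`, `m̂ = 1 − g^M_{L₀}·g^env_{R′,w′}`.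
[cite: ElgindiLissMattingly2025, §1.2.2 (cones and cocycle)] -/
theorem compat_symProd_H {γ ε εa a a₂ L R w R' w' : ℝ} (hγ : 0 ≤ γ) (hε : 0 < ε) (hεa : 0 < εa) (hL : 0 < L) (hw : 0 < w)
    (hw' : 0 < w') (ha₂ : a + εa + γ / (2 * L) ≤ a₂) (hR' : (1 + γ) * (R + w) + 1 / 2 ≤ R')
    {σ : ℝ} (hσ : σ = 1 ∨ σ = -1) (n : ℤ) (kh kv : ℤ) (hk : kh = n) :
    (1 - smoothTransition ((|(kh : ℝ)| - L / (1 + ε)) / (ε * (L / (1 + ε)))) *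
        (1 - smoothTransition ((γ * |((kv - round (σ * γ * n) : ℤ) : ℝ) + γ * kh| - a₂ * |(kh : ℝ)|) / (εa * (L / (1 + ε)))) *
          smoothTransition ((γ * |((kv - round (σ * γ * n) : ℤ) : ℝ) - γ * kh| - a₂ * |(kh : ℝ)|) / (εa * (L / (1 + ε))))) *
        ((1 - smoothTransition ((|(kh : ℝ)| - R') / w')) *
          (1 - smoothTransition ((|((kv - round (σ * γ * n) : ℤ) : ℝ)| - R') / w')))) ^ 2 ≤
      (1 - smoothTransition ((|(kh : ℝ)| - L) / (ε * L)) * (1 - smoothTransition ((γ * |(kv : ℝ)| - a * |(kh : ℝ)|) / (εa * L))) *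
        ((1 - smoothTransition ((|(kh : ℝ)| - R) / w)) * (1 - smoothTransition ((|(kv : ℝ)| - R) / w)))) ^ 2 := by
  have hL₀ : 0 < L / (1 + ε) := by positivity
  have hLL : (1 + ε) * (L / (1 + ε)) = L := by field_simp
  have hb : |((round (σ * γ * n) : ℤ) : ℝ) - σ * γ * kh| ≤ 1 / 2 := by rw [hk]; exact abs_round_sub_sigma_le σ γ n
  refine compat_mul (symS_nonneg γ ε εa a L kh kv) (symEnv_nonneg R w kh kv)
    (symM_nonneg γ ε εa a₂ (L / (1 + ε)) kh (kv - round (σ * γ * n)))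
    (symM_le_one γ ε εa a₂ (L / (1 + ε)) kh (kv - round (σ * γ * n)))
    (symEnv_nonneg R' w' kh (kv - round (σ * γ * n))) (symEnv_le_one R' w' kh (kv - round (σ * γ * n)))
    (fun hpos => ?_) (fun hpos => ?_)
  · -- cone step: `g^S ≠ 0 ⇒ g^M(·, · − b) = 1`
    refine eq_one_of_ne_zero_H (γ := γ) (a' := a + εa) (a₂ := a₂) (L := L) hγ hL (by linarith)
      (gS := fun kh kv => smoothTransition ((|(kh : ℝ)| - L) / (ε * L)) *
        (1 - smoothTransition ((γ * |(kv : ℝ)| - a * |(kh : ℝ)|) / (εa * L))))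
      (gM := fun kh kv => smoothTransition ((|(kh : ℝ)| - L / (1 + ε)) / (ε * (L / (1 + ε)))) *
        (1 - smoothTransition ((γ * |(kv : ℝ) + γ * kh| - a₂ * |(kh : ℝ)|) / (εa * (L / (1 + ε)))) *
          smoothTransition ((γ * |(kv : ℝ) - γ * kh| - a₂ * |(kh : ℝ)|) / (εa * (L / (1 + ε))))))
      (fun kh kv h => symS_supp hε hεa hL kh kv h)
      (fun kh kv σ' hσ' hkh hcone => symM_eq_one hε hεa hL₀ kh kv hσ' (by rw [hLL]; exact hkh.le) hcone)
      kh kv (round (σ * γ * n)) hσ hb hpos.ne'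
  · -- envelope step
    refine eq_one_of_ne_zero_env (γ := γ) (R := R + w) (R' := R') hγ hR'
      (g := fun ka kc => (1 - smoothTransition ((|(ka : ℝ)| - R) / w)) * (1 - smoothTransition ((|(kc : ℝ)| - R) / w)))
      (g' := fun ka kc => (1 - smoothTransition ((|(ka : ℝ)| - R') / w')) * (1 - smoothTransition ((|(kc : ℝ)| - R') / w')))
      (fun ka kc h => symEnv_supp hw ka kc h) (fun ka kc h1 h2 => symEnv_eq_one hw' ka kc h1.le h2.le)
      kh kv (round (σ * γ * n)) hσ hb hpos.ne'

/-- The lattice point shifted along `e_v`: components (`(k − b e₁) 0 = k 0`, `(k − b e₁) 1 = k 1 − b`), for rewriting the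
capstone's `m (k − Pi.single 1 b)` into the component form of `compat_symProd_H`. [folklore] -/
theorem sub_single_one_apply (k : Fin 2 → ℤ) (b : ℤ) :
    (k - Pi.single (1 : Fin 2) b : Fin 2 → ℤ) 0 = k 0 ∧ (k - Pi.single (1 : Fin 2) b : Fin 2 → ℤ) 1 = k 1 - b := by
  have h10 : (0 : Fin 2) ≠ 1 := by decide
  constructor
  · rw [Pi.sub_apply, Pi.single_eq_of_ne h10, sub_zero]
  · rw [Pi.sub_apply, Pi.single_eq_same]

/-- The same along `e_h` (V half-slot): `(k − b e₀) 0 = k 0 − b`, `(k − b e₀) 1 = k 1`. [folklore] -/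
theorem sub_single_zero_apply (k : Fin 2 → ℤ) (b : ℤ) :
    (k - Pi.single (0 : Fin 2) b : Fin 2 → ℤ) 0 = k 0 - b ∧ (k - Pi.single (0 : Fin 2) b : Fin 2 → ℤ) 1 = k 1 := by
  have h10 : (1 : Fin 2) ≠ 0 := by decide
  constructor
  · rw [Pi.sub_apply, Pi.single_eq_same]
  · rw [Pi.sub_apply, Pi.single_eq_of_ne h10, sub_zero]


/-! ## Appended: branch compatibility of the product symbols across the V half-slot -/

/-- **`hcomp` for the product symbols across the V half-slot.**  Old symbol `μ̂ = 1 − g^M_{L₀}·g^env_{R,w}`, new symbol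
`m̂′ = 1 − g^S_{L′}·g^env_{R′,w′}`, fibre `k_v = n′`, shift `b′ = round(σ′γn′)` along `k_h`.  Parameters: `γ ≥ 1`, `a ≥ 0`,
`ε, ε_a, L₀, L′, w, w′ > 0`, the cone condition with rounding margin `γ² + (a₂ + ε_a) + a/(2L₀) ≤ a(γ² − 1 − (a₂ + ε_a))`,
`a₂ + ε_a ≤ γ² − 1`, the new radius `(1+ε)L′ ≤ (γ² − 1 − (a₂ + ε_a))L₀ − ½`, envelopes `(1+γ)(R+w) + ½ ≤ R′`.  Then
`m̂′(k_h − b′, k_v)² ≤ μ̂(k_h, k_v)²` for `k_v = n′`. [cite: ElgindiLissMattingly2025, §3.1 Lemma 3.1 (cone invariance and expansion)] -/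
theorem compat_symProd_V {γ ε εa a a₂ L₀ L' R w R' w' : ℝ} (hγ : 1 ≤ γ) (ha : 0 ≤ a) (hε : 0 < ε) (hεa : 0 < εa)
    (hL₀ : 0 < L₀) (hL' : 0 < L') (hw : 0 < w) (hw' : 0 < w') (ha' : a₂ + εa ≤ γ ^ 2 - 1)
    (hca : γ ^ 2 + (a₂ + εa) + a / (2 * L₀) ≤ a * (γ ^ 2 - 1 - (a₂ + εa)))
    (hLL : (1 + ε) * L' ≤ (γ ^ 2 - 1 - (a₂ + εa)) * L₀ - 1 / 2) (hR' : (1 + γ) * (R + w) + 1 / 2 ≤ R')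
    {σ' : ℝ} (hσ' : σ' = 1 ∨ σ' = -1) (n' : ℤ) (kh kv : ℤ) (hk : kv = n') :
    (1 - smoothTransition ((|((kh - round (σ' * γ * n') : ℤ) : ℝ)| - L') / (ε * L')) *
        (1 - smoothTransition ((γ * |(kv : ℝ)| - a * |((kh - round (σ' * γ * n') : ℤ) : ℝ)|) / (εa * L'))) *
        ((1 - smoothTransition ((|((kh - round (σ' * γ * n') : ℤ) : ℝ)| - R') / w')) *
          (1 - smoothTransition ((|(kv : ℝ)| - R') / w')))) ^ 2 ≤
      (1 - smoothTransition ((|(kh : ℝ)| - L₀) / (ε * L₀)) *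
        (1 - smoothTransition ((γ * |(kv : ℝ) + γ * kh| - a₂ * |(kh : ℝ)|) / (εa * L₀)) *
          smoothTransition ((γ * |(kv : ℝ) - γ * kh| - a₂ * |(kh : ℝ)|) / (εa * L₀))) *
        ((1 - smoothTransition ((|(kh : ℝ)| - R) / w)) * (1 - smoothTransition ((|(kv : ℝ)| - R) / w)))) ^ 2 := by
  have hγ0 : 0 ≤ γ := by linarith
  have hb' : |((round (σ' * γ * n') : ℤ) : ℝ) - σ' * γ * kv| ≤ 1 / 2 := by rw [hk]; exact abs_round_sub_sigma_le σ' γ n'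
  refine compat_mul (symM_nonneg γ ε εa a₂ L₀ kh kv) (symEnv_nonneg R w kh kv)
    (symS_nonneg γ ε εa a L' (kh - round (σ' * γ * n')) kv) (symS_le_one γ ε εa a L' (kh - round (σ' * γ * n')) kv)
    (symEnv_nonneg R' w' (kh - round (σ' * γ * n')) kv) (symEnv_le_one R' w' (kh - round (σ' * γ * n')) kv)
    (fun hpos => ?_) (fun hpos => ?_)
  · -- cone step across V: `g^M ≠ 0 ⇒ g^{S'}(· − b', ·) = 1`
    exact eq_one_of_ne_zero_V (γ := γ) (a := a) (a' := a₂ + εa) (L := L₀) (L' := (1 + ε) * L') hγ ha hL₀ ha' hca hLL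
      (gM := fun kh kv => smoothTransition ((|(kh : ℝ)| - L₀) / (ε * L₀)) *
        (1 - smoothTransition ((γ * |(kv : ℝ) + γ * kh| - a₂ * |(kh : ℝ)|) / (εa * L₀)) *
          smoothTransition ((γ * |(kv : ℝ) - γ * kh| - a₂ * |(kh : ℝ)|) / (εa * L₀))))
      (gS' := fun kh kv => smoothTransition ((|(kh : ℝ)| - L') / (ε * L')) *
        (1 - smoothTransition ((γ * |(kv : ℝ)| - a * |(kh : ℝ)|) / (εa * L'))))
      (fun kh kv h => symM_supp hε hεa hL₀ kh kv h) (fun kh kv h1 h2 => symS_eq_one hε hεa hL' kh kv h1 h2)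
      kh kv (round (σ' * γ * n')) hσ' hb' hpos.ne'
  · -- envelope step across V
    exact eq_one_of_ne_zero_env_V (γ := γ) (R := R + w) (R' := R') hγ0 hR'
      (g := fun kh kv => (1 - smoothTransition ((|(kh : ℝ)| - R) / w)) * (1 - smoothTransition ((|(kv : ℝ)| - R) / w)))
      (g' := fun kh kv => (1 - smoothTransition ((|(kh : ℝ)| - R') / w')) * (1 - smoothTransition ((|(kv : ℝ)| - R') / w')))
      (fun kh kv h => symEnv_supp hw kh kv h) (fun kh kv h1 h2 => symEnv_eq_one hw' kh kv h1.le h2.le)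
      kh kv (round (σ' * γ * n')) hσ' hb' hpos.ne'

end Summit.AnomalousDissipation.AnomalousDissipation.Theorems.SawtoothPulseCascade.K1Symbol
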